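import Summits.KontsevichZagierPeriods.KontsevichZagierPeriods.Theorems.RootDecompQuadraticDescentPair18HomotopyP10

/-! # `RootDecompQuadraticDescentPair18HomotopyP11` — part 11/31 of the mechanical ≤400-line split of `Pair18Homotopy_v14_noguard.lean` (sha256 72e9c8442b4af820…)
Source: decomp-kz lens-6 g9 `Pair18Homotopy.lean` v14 (HOME/decomp-kz-lens-6/g9/, sha256 3dda3232…; critic g4-48/g4-53/g4-56/g5 CLEARED; census pair #18 of crux stmt-KontsevichZagierPeriods-28994: homotopy cells, duplications, inversions, Euler–Landen, arc/angle regions; terminal `pair18_g8strips_of_grid : hEuler → hGrid → hAng4 → (g8 form of #18)`); `#guard_msgs … #print axioms` pins removed for landing.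
Split by census-1 g9 `gen/splitlean.py`: scopes re-opened with their `open`/`variable`/`set_option` context; mathematics and declaration order unchanged. -/

set_option linter.unusedSimpArgs false
noncomputable section
open _root_.Set MvPolynomial
namespace Summit.KontsevichZagierPeriods.RootDecompQuadraticDescent.Pair18Homotopy
open Literature.NumberTheory.Transcendental
open Literature.NumberTheory.Transcendental.KZ (RFun cube)
open Summit.KontsevichZagierPeriods.RootDecompQuadraticDescent.DarkPairs (rel_reflect_rep rel_double)
/-- Auxiliary step `vec2_1` (§2b): vec2 1. [bookkeeping] -/
private theorem vec2_1 (a b : ℝ) : (![a, b] : Fin 2 → ℝ) 1 = b := rfl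

/-- Auxiliary step `vec2_0` (§2b): vec2 0. [bookkeeping] -/
private theorem vec2_0 (a b : ℝ) : (![a, b] : Fin 2 → ℝ) 0 = a := rfl

/-- Auxiliary step `cube2` (§0): cube2. [bookkeeping] -/
private theorem cube2 {x : Fin 2 → ℝ} (hx : x ∈ KZ.cube 2) : (0 ≤ x 0 ∧ x 0 ≤ 1) ∧ (0 ≤ x 1 ∧ x 1 ≤ 1) := ⟨hx 0, hx 1⟩

section Landen
open Literature.ModelTheory.ExponentialFields (IsSemialgebraic isSemialgebraic_setOf_eval_le
  isSemialgebraic_setOf_eval_pos)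

/-- `[U1] ≡ [W′]` by the Möbius self-map `u = 2v/(1+v)` (inverse of `v = u/(2−u)`… in the file's normalisation). -/
theorem U1_W' : KZ.of U1.rep - KZ.of W'.rep ∈ KZ.relations := by
  refine rel_moeb U1 W' fun z hz => ?_
  obtain ⟨h0, h1⟩ := cube2 hz
  have ha : (0 : ℝ) < 1 + z 0 := by linarith
  have hb : (0 : ℝ) < 1 + z 0 * z 1 := by nlinarith [mul_nonneg h0.1 h1.1]
  simp only [U1, W', QU1, W'Den, RFun.fn, map_add, map_sub, map_mul, map_pow, map_neg, aeval_C, aeval_X, map_one, map_ofNat, eq_ratCast, Rat.cast_one, Rat.cast_ofNat, Rat.cast_div, Rat.cast_neg, vec2_0, vec2_1, Matrix.cons_val_zero, Matrix.cons_val_one, Matrix.head_cons]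
  have e1 : (2 : ℝ) - 2 * z 0 / (1 + z 0) = 2 / (1 + z 0) := by field_simp; ring
  have e2 : (2 : ℝ) - 2 * z 0 / (1 + z 0) * (1 - z 1) = 2 * (1 + z 0 * z 1) / (1 + z 0) := by field_simp; ring
  rw [e1, e2]
  field_simp

/-- `[U1] − [U2r] ≡ [Lq]` (Euler–Landen: `π²/12 − Li₂(½) = ½log²2`, as a congruence of boxes). -/
theorem euler_rel : KZ.of U1.rep - KZ.of U2r.rep - KZ.of Lq.rep ∈ KZ.relations := by
  have e : KZ.of U1.rep - KZ.of U2r.rep - KZ.of Lq.rep = (KZ.of U1.rep - KZ.of W'.rep) + (KZ.of W'.rep - KZ.of W.rep)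
      + (KZ.of W.rep - KZ.of U2s.rep - KZ.of Lq.rep) + (KZ.of U2s.rep - KZ.of U2r.rep) := by abel
  rw [e]
  exact add_mem (add_mem (add_mem U1_W' W'_rel) landen_pt) U2s_rel

/-! ### `2•[Lq] ≡ [Lbox]`: the log² box is a half-square triangle -/

/-- null-piece removal: restricting a representation to a co-null semialgebraic subset is a relation. -/
theorem rel_restrict_null (r : KZ.IntegralRep 2) (s : Set (Fin 2 → ℝ)) (hs : IsSemialgebraic ℚ s)
    (hsub : s ⊆ r.domain) (hnull : MeasureTheory.volume (r.domain \ s) = 0) :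
    KZ.of r - KZ.of (r.restrict s hs hsub) ∈ KZ.relations := by
  have hd : IsSemialgebraic ℚ (r.domain \ s) := r.isSemialgebraic_domain.diff hs
  have h1 : KZ.of r - KZ.of (r.restrict s hs hsub) - KZ.of (r.restrict (r.domain \ s) hd sdiff_le) ∈
      KZ.relations := by
    refine KZ.domainAddRel_subset_relations
      ⟨2, r, r.restrict s hs hsub, r.restrict (r.domain \ s) hd sdiff_le, ?_, ?_, fun _ _ => rfl, fun _ _ => rfl, rfl⟩
    · simp only [KZ.IntegralRep.domain_restrict, Set.union_sdiff_cancel hsub]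
    · simp only [KZ.IntegralRep.domain_restrict, Set.inter_sdiff_self, MeasureTheory.measure_empty]
  have h2 : KZ.of (r.restrict (r.domain \ s) hd sdiff_le) - KZ.of (r.restrict (r.domain \ s) hd sdiff_le)
      - KZ.of (r.restrict (r.domain \ s) hd sdiff_le) ∈ KZ.relations := by
    refine KZ.domainAddRel_subset_relations
      ⟨2, _, _, _, ?_, ?_, fun _ _ => rfl, fun _ _ => rfl, rfl⟩
    · simp only [KZ.IntegralRep.domain_restrict, union_self]
    · simpa only [KZ.IntegralRep.domain_restrict, inter_self] using hnull
  have h3 : KZ.of (r.restrict (r.domain \ s) hd sdiff_le) ∈ KZ.relations := by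
    have e : KZ.of (r.restrict (r.domain \ s) hd sdiff_le) - KZ.of (r.restrict (r.domain \ s) hd sdiff_le)
        - KZ.of (r.restrict (r.domain \ s) hd sdiff_le) = -KZ.of (r.restrict (r.domain \ s) hd sdiff_le) := by
      abel
    rw [e] at h2
    exact neg_mem_iff.mp h2
  have e : KZ.of r - KZ.of (r.restrict s hs hsub) =
      (KZ.of r - KZ.of (r.restrict s hs hsub) - KZ.of (r.restrict (r.domain \ s) hd sdiff_le))
        + KZ.of (r.restrict (r.domain \ s) hd sdiff_le) := by abel
  rw [e]
  exact add_mem h1 h3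

/-- Auxiliary definition `NDen`: NDen. [bookkeeping] -/
def NDen : MvPolynomial (Fin 2) ℚ := (C 2 - X 0) * (C 2 - X 1)
/-- Auxiliary step `NDen_pos`: NDen pos. [bookkeeping] -/
theorem NDen_pos {x : Fin 2 → ℝ} (hx : x ∈ KZ.cube 2) : 0 < aeval x NDen := by
  obtain ⟨h0, h1⟩ := cube2 hx
  simp only [map_add, map_sub, map_mul, map_pow, map_neg, aeval_C, aeval_X, map_one, map_ofNat, eq_ratCast, Rat.cast_one, Rat.cast_ofNat, Rat.cast_div, Rat.cast_neg, vec2_0, vec2_1, Matrix.cons_val_zero, Matrix.cons_val_one, Matrix.head_cons, NDen]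
  have : (0 : ℝ) < 2 - x 0 := by linarith
  have : (0 : ℝ) < 2 - x 1 := by linarith
  positivity
/-- the tensor square `N = [□², 1/((2−x)(2−w))] = log²2`. -/
def N : RFun 2 := ⟨C 1, NDen, fun _ hx => (NDen_pos hx).ne'⟩
/-- Auxiliary definition `N₁Den`: N₁Den. [bookkeeping] -/
def N₁Den : MvPolynomial (Fin 2) ℚ := (C 1 + X 0) * (C 2 - X 1)
/-- Auxiliary step `N₁Den_pos`: N₁Den pos. [bookkeeping] -/
theorem N₁Den_pos {x : Fin 2 → ℝ} (hx : x ∈ KZ.cube 2) : 0 < aeval x N₁Den := by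
  obtain ⟨h0, h1⟩ := cube2 hx
  simp only [map_add, map_sub, map_mul, map_pow, map_neg, aeval_C, aeval_X, map_one, map_ofNat, eq_ratCast, Rat.cast_one, Rat.cast_ofNat, Rat.cast_div, Rat.cast_neg, vec2_0, vec2_1, Matrix.cons_val_zero, Matrix.cons_val_one, Matrix.head_cons, N₁Den]
  have : (0 : ℝ) < 1 + x 0 := by linarith
  have : (0 : ℝ) < 2 - x 1 := by linarith
  positivity
/-- Auxiliary definition `N₁`: N₁. [bookkeeping] -/
def N₁ : RFun 2 := ⟨C 1, N₁Den, fun _ hx => (N₁Den_pos hx).ne'⟩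

/-- Auxiliary step `N₁_rel`: N₁ rel. [bookkeeping] -/
theorem N₁_rel : KZ.of N₁.rep - KZ.of N.rep ∈ KZ.relations := by
  refine rel_reflect 0 N N₁ fun x hx => ?_
  simp only [N, N₁, NDen, N₁Den, RFun.fn, map_add, map_sub, map_mul, map_pow, map_neg, aeval_C, aeval_X, map_one, map_ofNat, eq_ratCast, Rat.cast_one, Rat.cast_ofNat, Rat.cast_div, Rat.cast_neg, vec2_0, vec2_1, Matrix.cons_val_zero, Matrix.cons_val_one, Matrix.head_cons, Function.update_self,
    Function.update_of_ne (show (1 : Fin 2) ≠ 0 by decide)]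
  ring_nf

/-- Auxiliary step `Lbox_N₁`: Lbox N₁. [bookkeeping] -/
theorem Lbox_N₁ : KZ.of Lbox.rep - KZ.of N₁.rep ∈ KZ.relations := by
  refine rel_reflect 1 N₁ Lbox fun x hx => ?_
  simp only [N₁, Lbox, N₁Den, LboxDen, RFun.fn, map_add, map_sub, map_mul, map_pow, map_neg, aeval_C, aeval_X, map_one, map_ofNat, eq_ratCast, Rat.cast_one, Rat.cast_ofNat, Rat.cast_div, Rat.cast_neg, vec2_0, vec2_1, Matrix.cons_val_zero, Matrix.cons_val_one, Matrix.head_cons, Function.update_self,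
    Function.update_of_ne (show (0 : Fin 2) ≠ 1 by decide)]
  ring_nf

/-- the positive part of the square `{x > 0}` and the triangles `{w ≤ x}`, `{x ≤ w}`. -/
def SqP : Set (Fin 2 → ℝ) := cube 2 ∩ {z | 0 < z 0}
/-- Auxiliary definition `TriL`: Tri L. [bookkeeping] -/
def TriL : Set (Fin 2 → ℝ) := cube 2 ∩ {z | z 1 ≤ z 0}
/-- Auxiliary definition `TriLP`: Tri LP. [bookkeeping] -/
def TriLP : Set (Fin 2 → ℝ) := cube 2 ∩ {z | z 1 ≤ z 0} ∩ {z | 0 < z 0}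
/-- Auxiliary definition `TriU`: Tri U. [bookkeeping] -/
def TriU : Set (Fin 2 → ℝ) := cube 2 ∩ {z | z 0 ≤ z 1}

/-- Auxiliary step `isSemialgebraic_pos0`: is Semialgebraic pos0. [bookkeeping] -/
private theorem isSemialgebraic_pos0 : IsSemialgebraic ℚ {z : Fin 2 → ℝ | 0 < z 0} := by
  have h := isSemialgebraic_setOf_eval_pos (R := ℝ) (X 0 : MvPolynomial (Fin 2) ℚ)
  have e : {x : Fin 2 → ℝ | 0 < aeval x (X 0 : MvPolynomial (Fin 2) ℚ)} = {z | 0 < z 0} := by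
    ext z; simp only [mem_setOf_eq, aeval_X]
  rw [e] at h; exact h
/-- Auxiliary step `isSemialgebraic_le4`: is Semialgebraic le4. [bookkeeping] -/
theorem isSemialgebraic_le4 : IsSemialgebraic ℚ {z : Fin 2 → ℝ | z 1 ≤ z 0} := by
  have h := isSemialgebraic_setOf_eval_le (R := ℝ) (X 1 : MvPolynomial (Fin 2) ℚ) (X 0 : MvPolynomial (Fin 2) ℚ)
  have e : {x : Fin 2 → ℝ | aeval x (X 1 : MvPolynomial (Fin 2) ℚ) ≤ aeval x (X 0 : MvPolynomial (Fin 2) ℚ)} =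
      {z | z 1 ≤ z 0} := by
    ext z; simp only [mem_setOf_eq, aeval_X]
  rw [e] at h; exact h
/-- Auxiliary step `isSemialgebraic_le5`: is Semialgebraic le5. [bookkeeping] -/
theorem isSemialgebraic_le5 : IsSemialgebraic ℚ {z : Fin 2 → ℝ | z 0 ≤ z 1} := by
  have h := isSemialgebraic_setOf_eval_le (R := ℝ) (X 0 : MvPolynomial (Fin 2) ℚ) (X 1 : MvPolynomial (Fin 2) ℚ)
  have e : {x : Fin 2 → ℝ | aeval x (X 0 : MvPolynomial (Fin 2) ℚ) ≤ aeval x (X 1 : MvPolynomial (Fin 2) ℚ)} =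
      {z | z 0 ≤ z 1} := by
    ext z; simp only [mem_setOf_eq, aeval_X]
  rw [e] at h; exact h
/-- Auxiliary step `isSemialgebraic_SqP`: is Semialgebraic Sq P. [bookkeeping] -/
theorem isSemialgebraic_SqP : IsSemialgebraic ℚ SqP := KZ.isSemialgebraic_cube.inter isSemialgebraic_pos0
/-- Auxiliary step `isSemialgebraic_TriL`: is Semialgebraic Tri L. [bookkeeping] -/
theorem isSemialgebraic_TriL : IsSemialgebraic ℚ TriL := KZ.isSemialgebraic_cube.inter isSemialgebraic_le4
/-- Auxiliary step `isSemialgebraic_TriLP`: is Semialgebraic Tri LP. [bookkeeping] -/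
theorem isSemialgebraic_TriLP : IsSemialgebraic ℚ TriLP :=
  (KZ.isSemialgebraic_cube.inter isSemialgebraic_le4).inter isSemialgebraic_pos0
/-- Auxiliary step `isSemialgebraic_TriU`: is Semialgebraic Tri U. [bookkeeping] -/
theorem isSemialgebraic_TriU : IsSemialgebraic ℚ TriU := KZ.isSemialgebraic_cube.inter isSemialgebraic_le5
/-- Auxiliary step `SqP_sub`: Sq P sub. [bookkeeping] -/
theorem SqP_sub : SqP ⊆ Lq.rep.domain := fun _ hz => hz.1
/-- Auxiliary step `TriL_sub`: Tri L sub. [bookkeeping] -/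
theorem TriL_sub : TriL ⊆ N.rep.domain := fun _ hz => hz.1
/-- Auxiliary step `TriLP_sub`: Tri LP sub. [bookkeeping] -/
theorem TriLP_sub : TriLP ⊆ (N.rep.restrict TriL isSemialgebraic_TriL TriL_sub).domain := fun _ hz => hz.1
/-- Auxiliary step `TriU_sub`: Tri U sub. [bookkeeping] -/
theorem TriU_sub : TriU ⊆ N.rep.domain := fun _ hz => hz.1

/-- Auxiliary definition `LqP`: Lq P. [bookkeeping] -/
def LqP : KZ.IntegralRep 2 := Lq.rep.restrict SqP isSemialgebraic_SqP SqP_sub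
/-- Auxiliary definition `NL`: NL. [bookkeeping] -/
def NL : KZ.IntegralRep 2 := N.rep.restrict TriL isSemialgebraic_TriL TriL_sub
/-- Auxiliary definition `NLP`: NLP. [bookkeeping] -/
def NLP : KZ.IntegralRep 2 := NL.restrict TriLP isSemialgebraic_TriLP TriLP_sub
/-- Auxiliary definition `NU`: NU. [bookkeeping] -/
def NU : KZ.IntegralRep 2 := N.rep.restrict TriU isSemialgebraic_TriU TriU_sub

/-- Auxiliary step `volume_edge`: volume edge. [bookkeeping] -/
theorem volume_edge : MeasureTheory.volume {z : Fin 2 → ℝ | z 0 = 0} = 0 := by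
  have h := volume_setOf_aeval_eq_zero (k := ℚ) (m := 2) (X 0 : MvPolynomial (Fin 2) ℚ) (by
    rw [MvPolynomial.map_X]; exact MvPolynomial.X_ne_zero 0)
  have e : {x : Fin 2 → ℝ | aeval x (X 0 : MvPolynomial (Fin 2) ℚ) = 0} = {z | z 0 = 0} := by
    ext z; simp only [mem_setOf_eq, aeval_X]
  rw [e] at h; exact h
/-- Auxiliary step `volume_diag`: volume diag. [bookkeeping] -/
theorem volume_diag : MeasureTheory.volume {z : Fin 2 → ℝ | z 0 = z 1} = 0 := by
  have h := volume_setOf_aeval_eq_zero (k := ℚ) (m := 2) (X 0 - X 1 : MvPolynomial (Fin 2) ℚ) (by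
    rw [map_sub, MvPolynomial.map_X, MvPolynomial.map_X]
    intro h0
    have := congrArg (MvPolynomial.coeff (Finsupp.single 0 1)) h0
    simp [MvPolynomial.coeff_X, Finsupp.single_eq_single_iff] at this)
  have e : {x : Fin 2 → ℝ | aeval x (X 0 - X 1 : MvPolynomial (Fin 2) ℚ) = 0} = {z | z 0 = z 1} := by
    ext z; simp only [mem_setOf_eq, map_sub, aeval_X, sub_eq_zero]
  rw [e] at h; exact h

/-- Auxiliary step `Lq_P`: Lq P. [bookkeeping] -/
theorem Lq_P : KZ.of Lq.rep - KZ.of LqP ∈ KZ.relations := by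
  refine rel_restrict_null Lq.rep SqP isSemialgebraic_SqP SqP_sub (MeasureTheory.measure_mono_null ?_ volume_edge)
  intro z hz
  rw [RFun.rep_domain] at hz
  obtain ⟨hz, hn⟩ := hz
  simp only [SqP, mem_inter_iff, mem_setOf_eq, not_and, not_lt] at hn
  exact le_antisymm (hn hz) (hz 0).1
/-- Auxiliary step `NL_P`: NL P. [bookkeeping] -/
theorem NL_P : KZ.of NL - KZ.of NLP ∈ KZ.relations := by
  refine rel_restrict_null NL TriLP isSemialgebraic_TriLP TriLP_sub (MeasureTheory.measure_mono_null ?_ volume_edge)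
  intro z hz
  simp only [NL, KZ.IntegralRep.domain_restrict] at hz
  obtain ⟨hz, hn⟩ := hz
  simp only [TriLP, TriL, mem_inter_iff, mem_setOf_eq, not_and, not_lt] at hn hz
  exact le_antisymm (hn hz) (hz.1 0).1

/-- the degenerate shear `(x,y) ↦ (x, xy)` on `{x > 0}`: `[Lq|x>0] ≡ [N|{w ≤ x, x > 0}]`. -/
theorem LqP_cov : KZ.of LqP - KZ.of NLP ∈ KZ.relations := by
  let Φ : (Fin 2 → ℝ) → (Fin 2 → ℝ) := fun z => ![z 0, z 0 * z 1]
  let Mz : (Fin 2 → ℝ) → Matrix (Fin 2) (Fin 2) ℝ := fun z => !![1, 0; z 1, z 0]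
  let Φ' : (Fin 2 → ℝ) → (Fin 2 → ℝ) →L[ℝ] (Fin 2 → ℝ) := fun z =>
    LinearMap.toContinuousLinearMap (Matrix.toLin' (Mz z))
  have hΦ'ap : ∀ z w, Φ' z w = ![w 0, z 1 * w 0 + z 0 * w 1] := by
    intro z w; funext i
    fin_cases i <;> simp [Φ', Mz, Matrix.toLin'_apply, Matrix.mulVec, dotProduct, Fin.sum_univ_two]
  have hdet : ∀ z, (Φ' z).det = z 0 := by
    intro z
    unfold ContinuousLinearMap.det
    simp [Φ', LinearMap.det_toLin', Mz, Matrix.det_fin_two]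
  have hdom : NLP.domain = Φ '' LqP.domain := by
    simp only [NLP, NL, LqP, KZ.IntegralRep.domain_restrict, RFun.rep_domain]
    ext w
    constructor
    · rintro ⟨⟨hw, hle⟩, hpos⟩
      simp only [mem_setOf_eq] at hle hpos
      have hw0' := (hw 0).2
      have hw1 := (hw 1).1
      refine ⟨![w 0, w 1 / w 0], ⟨?_, ?_⟩, ?_⟩
      · intro i
        fin_cases i
        · simpa using hw 0
        · exact ⟨by simpa using div_nonneg hw1 hpos.le, by simpa using (div_le_one hpos).mpr hle⟩
      · simpa using hpos
      · funext i
        fin_cases i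
        · simp [Φ]
        · have key : w 0 * (w 1 / w 0) = w 1 := by field_simp
          simpa [Φ] using key
    · rintro ⟨z, ⟨hz, hpos⟩, rfl⟩
      simp only [mem_setOf_eq] at hpos
      have hz0 := (hz 0).1
      have hz0' := (hz 0).2
      have hz1 := (hz 1).1
      have hz1' := (hz 1).2
      refine ⟨⟨fun i => ?_, ?_⟩, ?_⟩
      · fin_cases i
        · simpa [Φ] using hz 0
        · exact ⟨by simp [Φ]; positivity, by simp [Φ]; nlinarith⟩
      · simp only [mem_setOf_eq, Φ, vec2_0, vec2_1, Matrix.cons_val_zero, Matrix.cons_val_one, Matrix.head_cons]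
        nlinarith
      · simpa [Φ] using hpos
  refine KZ.changeOfVariablesRel_subset_relations ⟨2, LqP, NLP, Φ, Φ', ?_, ?_, ?_, hdom, ?_, rfl⟩
  · have hsd : IsSemialgebraic ℚ LqP.domain := LqP.isSemialgebraic_domain
    refine (isSemialgebraicMapOn_iff_forall_holds hsd).mpr fun i => ?_
    fin_cases i
    · exact (isSemialgebraicFunOn_aeval hsd (X 0)).congr fun z _ => by simp [Φ]
    · exact (isSemialgebraicFunOn_aeval hsd (X 0 * X 1)).congr fun z _ => by simp [Φ]
  · intro z hz
    have h0 : HasFDerivAt (fun w : Fin 2 → ℝ => w 0)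
        (ContinuousLinearMap.proj (R := ℝ) (φ := fun _ : Fin 2 => ℝ) 0) z := hasFDerivAt_apply 0 z
    have h1 : HasFDerivAt (fun w : Fin 2 → ℝ => w 0 * w 1)
        (z 0 • ContinuousLinearMap.proj (R := ℝ) (φ := fun _ : Fin 2 => ℝ) 1 +
          z 1 • ContinuousLinearMap.proj (R := ℝ) (φ := fun _ : Fin 2 => ℝ) 0) z :=
      (hasFDerivAt_apply (𝕜 := ℝ) 0 z).mul (hasFDerivAt_apply (𝕜 := ℝ) 1 z)
    have hpi : HasFDerivAt Φ (Φ' z) z := by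
      rw [hasFDerivAt_pi']
      intro i
      fin_cases i
      · have e : (ContinuousLinearMap.proj (R := ℝ) (φ := fun _ : Fin 2 => ℝ) 0).comp (Φ' z) =
            ContinuousLinearMap.proj (R := ℝ) (φ := fun _ : Fin 2 => ℝ) 0 := by
          ext w; simp [hΦ'ap]
        simpa [e, Φ] using h0
      · have e : (ContinuousLinearMap.proj (R := ℝ) (φ := fun _ : Fin 2 => ℝ) 1).comp (Φ' z) =
            z 0 • ContinuousLinearMap.proj (R := ℝ) (φ := fun _ : Fin 2 => ℝ) 1 +
              z 1 • ContinuousLinearMap.proj (R := ℝ) (φ := fun _ : Fin 2 => ℝ) 0 := by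
          ext w; simp [hΦ'ap]; try ring
        simpa [e, Φ, Function.comp_def] using h1
    exact hpi.hasFDerivWithinAt
  · intro z₁ hz₁ z₂ hz₂ heq
    have hp : 0 < z₁ 0 := by
      have := hz₁.2; simpa [LqP, KZ.IntegralRep.domain_restrict, SqP] using this
    have e0 : z₁ 0 = z₂ 0 := by simpa [Φ] using congrFun heq 0
    have e1 : z₁ 0 * z₁ 1 = z₂ 0 * z₂ 1 := by simpa [Φ] using congrFun heq 1
    rw [← e0] at e1
    have e1' : z₁ 1 = z₂ 1 := mul_left_cancel₀ hp.ne' e1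
    funext i
    fin_cases i
    · exact e0
    · exact e1'
  · intro z hz
    have hz' : z ∈ cube 2 ∧ 0 < z 0 := by
      simpa [LqP, KZ.IntegralRep.domain_restrict, SqP] using hz
    obtain ⟨h0, h1⟩ := cube2 hz'.1
    have hp := hz'.2
    have ha : (0 : ℝ) < 2 - z 0 * z 1 := by nlinarith [mul_le_one₀ h0.2 h1.1 h1.2]
    have hb : (0 : ℝ) < 2 - z 0 := by linarith
    rw [hdet z, abs_of_pos hp]
    simp only [LqP, NLP, NL, KZ.IntegralRep.integrand_restrict, RFun.rep_integrand]
    simp only [Lq, N, WDen, NDen, RFun.fn, Φ, map_add, map_sub, map_mul, map_pow, map_neg, aeval_C, aeval_X, map_one, map_ofNat, eq_ratCast, Rat.cast_one, Rat.cast_ofNat, Rat.cast_div, Rat.cast_neg, vec2_0, vec2_1, Matrix.cons_val_zero, Matrix.cons_val_one, Matrix.head_cons]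
    field_simp

end Landen
end Summit.KontsevichZagierPeriods.RootDecompQuadraticDescent.Pair18Homotopy
end
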